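import Summits.Ventures.Crystal3D.Bulk.GapTightLevels
import HarnessLib

/-!
# Empty cells: no direction of an admissible configuration lies inside a tight x-triangle, a
# tight p-triangle or a tight x-rhombus ((d1) for triangles and rhombi, face-free)

HONEST FRAMING. Part of the venture `Summits/Ventures/Crystal3D` (cell `pub-crystal3d`, phase 2,
24-hour sprint `PLAN.md` R42/R43; seat typer-bulk-2). The census prune (d1)(d2) of
`phase2/ENV-CENSUS/DESIGN-L12-THEORY.md` ("rattlers lie only inside p-HEXAGONS", SCORE-DESIGN
§14) says in particular that no shell direction lies inside a tight triangle, a tight p-triangle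
or a tight rhombus. THIS file proves those three cases for EVERY admissible configuration, in
cone form and without any face theory: a unit vector at inner product `≤ 1/2` (resp. `≤ D/2`
from the hole direction) from the corners cannot be a nonnegative combination of them.

* abstract lemmas (any real inner product space): `not_comb3_of_inner_le` (three unit vectors
  pairwise at `1/2`; a unit `x` with `⟪x, ·⟫ ≤ s`, `3s² < 2`, is not in their cone),
  `not_comb_pTriangle_of_inner_le` (cone of `p, a, b` with `⟪p,a⟫ = ⟪p,b⟫ = t`, `⟪a,b⟫ = 1/2`;
  a unit `x` with `⟪x,p⟫ ≤ t`, `⟪x,a⟫, ⟪x,b⟫ ≤ 1/2` is not in it), `inner_ge_neg_half_of_touch`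
  (`⟪a, e⟫ ≥ −1/2` when `a, e` touch a common `b`), `not_comb4_rhombus_of_inner_le`;
* configuration rows: **`IsGapConfig.not_in_xTriangle`** (no other ball's direction — shell, or
  the hole when `D² < 8/3` — in the closed cone of a tight shell triangle),
  **`IsGapConfig.not_in_pTriangle`** (no shell direction in the cone of a tight `p`-triangle),
  **`IsGapConfig.not_in_xRhombus`** (no shell direction in the cone of a tight shell 4-cycle).

Pentagons, p-quadrilaterals and p-pentagons (the rest of (d1)) need the §14 argument and are NOT
here. Nothing is claimed about GAP(1.26).
-/

noncomputable section

open scoped BigOperators InnerProductSpace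
open Finset Real

namespace Summit.Ventures.Crystal3D

/-! ## Abstract cone lemmas -/

section Abstract

variable {F : Type*} [NormedAddCommGroup F] [InnerProductSpace ℝ F]

/-- **No separated unit vector in the cone of a tight triangle.** Unit `a, b, d` pairwise at inner
product `1/2`; a unit `x` with `⟪x, a⟫, ⟪x, b⟫, ⟪x, d⟫ ≤ s` where `0 ≤ s` and `3 s² < 2` is not
of the form `α a + β b + γ d` with `α, β, γ ≥ 0`: pairing `x` with itself gives
`1 ≤ s (α+β+γ)`, pairing with `a, b, d` and adding gives `2(α+β+γ) ≤ 3 s`. -/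
theorem not_comb3_of_inner_le {a b d x : F} (ha : ‖a‖ = 1) (hb : ‖b‖ = 1) (hd : ‖d‖ = 1)
    (hx : ‖x‖ = 1) (hab : ⟪a, b⟫_ℝ = 1 / 2) (had : ⟪a, d⟫_ℝ = 1 / 2) (hbd : ⟪b, d⟫_ℝ = 1 / 2)
    {s : ℝ} (hs0 : 0 ≤ s) (hs : 3 * s ^ 2 < 2) (hxa : ⟪x, a⟫_ℝ ≤ s) (hxb : ⟪x, b⟫_ℝ ≤ s)
    (hxd : ⟪x, d⟫_ℝ ≤ s) {α β γ : ℝ} (hα : 0 ≤ α) (hβ : 0 ≤ β) (hγ : 0 ≤ γ)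
    (h : x = α • a + β • b + γ • d) : False := by
  have haa : ⟪a, a⟫_ℝ = 1 := by rw [real_inner_self_eq_norm_sq, ha]; norm_num
  have hbb : ⟪b, b⟫_ℝ = 1 := by rw [real_inner_self_eq_norm_sq, hb]; norm_num
  have hdd : ⟪d, d⟫_ℝ = 1 := by rw [real_inner_self_eq_norm_sq, hd]; norm_num
  have hxx : ⟪x, x⟫_ℝ = 1 := by rw [real_inner_self_eq_norm_sq, hx]; norm_num
  have hba : ⟪b, a⟫_ℝ = 1 / 2 := by rw [real_inner_comm]; exact hab
  have hda : ⟪d, a⟫_ℝ = 1 / 2 := by rw [real_inner_comm]; exact had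
  have hdb : ⟪d, b⟫_ℝ = 1 / 2 := by rw [real_inner_comm]; exact hbd
  -- pair `x` with itself
  have e0 : ⟪x, x⟫_ℝ = α * ⟪x, a⟫_ℝ + β * ⟪x, b⟫_ℝ + γ * ⟪x, d⟫_ℝ := by
    calc ⟪x, x⟫_ℝ = ⟪x, α • a + β • b + γ • d⟫_ℝ := by rw [← h]
      _ = α * ⟪x, a⟫_ℝ + β * ⟪x, b⟫_ℝ + γ * ⟪x, d⟫_ℝ := by
          simp only [inner_add_right, real_inner_smul_right]
  rw [hxx] at e0
  have i0 : 1 ≤ s * (α + β + γ) := by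
    nlinarith [mul_le_mul_of_nonneg_left hxa hα, mul_le_mul_of_nonneg_left hxb hβ,
      mul_le_mul_of_nonneg_left hxd hγ]
  -- pair `x` with `a`, `b`, `d`
  have ea : ⟪x, a⟫_ℝ = α + β * (1 / 2) + γ * (1 / 2) := by
    rw [h]; simp only [inner_add_left, real_inner_smul_left, haa, hba, hda]; ring
  have eb : ⟪x, b⟫_ℝ = α * (1 / 2) + β + γ * (1 / 2) := by
    rw [h]; simp only [inner_add_left, real_inner_smul_left, hab, hbb, hdb]; ring
  have ed : ⟪x, d⟫_ℝ = α * (1 / 2) + β * (1 / 2) + γ := by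
    rw [h]; simp only [inner_add_left, real_inner_smul_left, had, hbd, hdd]; ring
  have i1 : 2 * (α + β + γ) ≤ 3 * s := by linarith
  -- `1 ≤ s S` and `S ≤ 3s/2` give `2 ≤ 3 s²`
  nlinarith [mul_le_mul_of_nonneg_left i1 hs0]

/-- **No separated unit vector in the cone of a tight `p`-triangle.** Unit `p, a, b` with
`⟪p, a⟫ = ⟪p, b⟫ = t`, `⟪a, b⟫ = 1/2`; a unit `x` with `⟪x, p⟫ ≤ t`, `⟪x, a⟫, ⟪x, b⟫ ≤ 1/2` is not
`α p + β a + γ b` with `α, β, γ ≥ 0` (any `t`): `1 ≤ αt + (β+γ)/2` against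
`2αt + (3/2)(β+γ) ≤ 1`. -/
theorem not_comb_pTriangle_of_inner_le {p a b x : F} (hp : ‖p‖ = 1) (ha : ‖a‖ = 1) (hb : ‖b‖ = 1)
    (hx : ‖x‖ = 1) {t : ℝ} (hpa : ⟪p, a⟫_ℝ = t) (hpb : ⟪p, b⟫_ℝ = t) (hab : ⟪a, b⟫_ℝ = 1 / 2)
    (hxp : ⟪x, p⟫_ℝ ≤ t) (hxa : ⟪x, a⟫_ℝ ≤ 1 / 2) (hxb : ⟪x, b⟫_ℝ ≤ 1 / 2) {α β γ : ℝ}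
    (hα : 0 ≤ α) (hβ : 0 ≤ β) (hγ : 0 ≤ γ) (h : x = α • p + β • a + γ • b) : False := by
  have haa : ⟪a, a⟫_ℝ = 1 := by rw [real_inner_self_eq_norm_sq, ha]; norm_num
  have hbb : ⟪b, b⟫_ℝ = 1 := by rw [real_inner_self_eq_norm_sq, hb]; norm_num
  have hxx : ⟪x, x⟫_ℝ = 1 := by rw [real_inner_self_eq_norm_sq, hx]; norm_num
  have _hpp : ⟪p, p⟫_ℝ = 1 := by rw [real_inner_self_eq_norm_sq, hp]; norm_num
  have hba : ⟪b, a⟫_ℝ = 1 / 2 := by rw [real_inner_comm]; exact hab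
  have e0 : ⟪x, x⟫_ℝ = α * ⟪x, p⟫_ℝ + β * ⟪x, a⟫_ℝ + γ * ⟪x, b⟫_ℝ := by
    calc ⟪x, x⟫_ℝ = ⟪x, α • p + β • a + γ • b⟫_ℝ := by rw [← h]
      _ = α * ⟪x, p⟫_ℝ + β * ⟪x, a⟫_ℝ + γ * ⟪x, b⟫_ℝ := by
          simp only [inner_add_right, real_inner_smul_right]
  rw [hxx] at e0
  have i0 : 1 ≤ α * t + (β + γ) * (1 / 2) := by
    nlinarith [mul_le_mul_of_nonneg_left hxp hα, mul_le_mul_of_nonneg_left hxa hβ,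
      mul_le_mul_of_nonneg_left hxb hγ]
  have ea : ⟪x, a⟫_ℝ = α * t + β + γ * (1 / 2) := by
    rw [h]; simp only [inner_add_left, real_inner_smul_left, hpa, haa, hba]; ring
  have eb : ⟪x, b⟫_ℝ = α * t + β * (1 / 2) + γ := by
    rw [h]; simp only [inner_add_left, real_inner_smul_left, hpb, hab, hbb]; ring
  have i1 : 2 * (α * t) + 3 / 2 * (β + γ) ≤ 1 := by linarith
  linarith

/-- Two unit vectors touching a common unit vector `b` (`⟪a, b⟫ = ⟪e, b⟫ = 1/2`) satisfy
`⟪a, e⟫ ≥ −1/2` (they are at angular distance `≤ 120°`): `1 = ⟪a + e, b⟫ ≤ ‖a + e‖`. -/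
theorem inner_ge_neg_half_of_touch {a e b : F} (ha : ‖a‖ = 1) (he : ‖e‖ = 1) (hb : ‖b‖ = 1)
    (hab : ⟪a, b⟫_ℝ = 1 / 2) (heb : ⟪e, b⟫_ℝ = 1 / 2) : -(1 / 2) ≤ ⟪a, e⟫_ℝ := by
  have h1 : ⟪a + e, b⟫_ℝ = 1 := by rw [inner_add_left, hab, heb]; norm_num
  have h2 : ⟪a + e, b⟫_ℝ ≤ ‖a + e‖ * ‖b‖ := real_inner_le_norm _ _
  rw [h1, hb, mul_one] at h2
  have h3 : ‖a + e‖ ^ 2 = 2 + 2 * ⟪a, e⟫_ℝ := by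
    rw [← real_inner_self_eq_norm_sq, inner_add_left, inner_add_right, inner_add_right,
      real_inner_self_eq_norm_sq, real_inner_self_eq_norm_sq, ha, he, real_inner_comm a e]
    ring
  nlinarith [h2, h3, norm_nonneg (a + e)]

/-- **No separated unit vector in the cone of a tight rhombus.** Unit `a, b, e, d` with the cycle
contacts `⟪a,b⟫ = ⟪b,e⟫ = ⟪e,d⟫ = ⟪d,a⟫ = 1/2`; a unit `x` with `⟪x, ·⟫ ≤ 1/2` at all four is not
`α a + β b + γ e + δ d` with nonnegative coefficients: `1 ≤ S/2` against
`(3/2) S ≤ Σ pairings ≤ 2` (the diagonals have inner product `≥ −1/2`). -/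
theorem not_comb4_rhombus_of_inner_le {a b e d x : F} (ha : ‖a‖ = 1) (hb : ‖b‖ = 1)
    (he : ‖e‖ = 1) (hd : ‖d‖ = 1) (hx : ‖x‖ = 1) (hab : ⟪a, b⟫_ℝ = 1 / 2) (hbe : ⟪b, e⟫_ℝ = 1 / 2)
    (hed : ⟪e, d⟫_ℝ = 1 / 2) (hda : ⟪d, a⟫_ℝ = 1 / 2) (hxa : ⟪x, a⟫_ℝ ≤ 1 / 2)
    (hxb : ⟪x, b⟫_ℝ ≤ 1 / 2) (hxe : ⟪x, e⟫_ℝ ≤ 1 / 2) (hxd : ⟪x, d⟫_ℝ ≤ 1 / 2) {α β γ δ : ℝ}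
    (hα : 0 ≤ α) (hβ : 0 ≤ β) (hγ : 0 ≤ γ) (hδ : 0 ≤ δ)
    (h : x = α • a + β • b + γ • e + δ • d) : False := by
  have haa : ⟪a, a⟫_ℝ = 1 := by rw [real_inner_self_eq_norm_sq, ha]; norm_num
  have hbb : ⟪b, b⟫_ℝ = 1 := by rw [real_inner_self_eq_norm_sq, hb]; norm_num
  have hee : ⟪e, e⟫_ℝ = 1 := by rw [real_inner_self_eq_norm_sq, he]; norm_num
  have hdd : ⟪d, d⟫_ℝ = 1 := by rw [real_inner_self_eq_norm_sq, hd]; norm_num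
  have hxx : ⟪x, x⟫_ℝ = 1 := by rw [real_inner_self_eq_norm_sq, hx]; norm_num
  have hba : ⟪b, a⟫_ℝ = 1 / 2 := by rw [real_inner_comm]; exact hab
  have heb : ⟪e, b⟫_ℝ = 1 / 2 := by rw [real_inner_comm]; exact hbe
  have hde : ⟪d, e⟫_ℝ = 1 / 2 := by rw [real_inner_comm]; exact hed
  have had : ⟪a, d⟫_ℝ = 1 / 2 := by rw [real_inner_comm]; exact hda
  -- the diagonals
  have hae : -(1 / 2) ≤ ⟪a, e⟫_ℝ := inner_ge_neg_half_of_touch ha he hb hab heb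
  have hbd : -(1 / 2) ≤ ⟪b, d⟫_ℝ :=
    inner_ge_neg_half_of_touch hb hd ha hba (by rw [real_inner_comm]; exact had)
  have hea : ⟪e, a⟫_ℝ = ⟪a, e⟫_ℝ := real_inner_comm _ _
  have hdb : ⟪d, b⟫_ℝ = ⟪b, d⟫_ℝ := real_inner_comm _ _
  have e0 : ⟪x, x⟫_ℝ = α * ⟪x, a⟫_ℝ + β * ⟪x, b⟫_ℝ + γ * ⟪x, e⟫_ℝ + δ * ⟪x, d⟫_ℝ := by
    calc ⟪x, x⟫_ℝ = ⟪x, α • a + β • b + γ • e + δ • d⟫_ℝ := by rw [← h]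
      _ = α * ⟪x, a⟫_ℝ + β * ⟪x, b⟫_ℝ + γ * ⟪x, e⟫_ℝ + δ * ⟪x, d⟫_ℝ := by
          simp only [inner_add_right, real_inner_smul_right]
  rw [hxx] at e0
  have i0 : 1 ≤ (α + β + γ + δ) * (1 / 2) := by
    nlinarith [mul_le_mul_of_nonneg_left hxa hα, mul_le_mul_of_nonneg_left hxb hβ,
      mul_le_mul_of_nonneg_left hxe hγ, mul_le_mul_of_nonneg_left hxd hδ]
  have ea : ⟪x, a⟫_ℝ = α + β * (1 / 2) + γ * ⟪a, e⟫_ℝ + δ * (1 / 2) := by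
    rw [h]; simp only [inner_add_left, real_inner_smul_left, haa, hba, hea, hda]; ring
  have eb : ⟪x, b⟫_ℝ = α * (1 / 2) + β + γ * (1 / 2) + δ * ⟪b, d⟫_ℝ := by
    rw [h]; simp only [inner_add_left, real_inner_smul_left, hab, hbb, heb, hdb]; ring
  have ee : ⟪x, e⟫_ℝ = α * ⟪a, e⟫_ℝ + β * (1 / 2) + γ + δ * (1 / 2) := by
    rw [h]; simp only [inner_add_left, real_inner_smul_left, hbe, hee, hde]; ring
  have ed : ⟪x, d⟫_ℝ = α * (1 / 2) + β * ⟪b, d⟫_ℝ + γ * (1 / 2) + δ := by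
    rw [h]; simp only [inner_add_left, real_inner_smul_left, had, hed, hdd]; ring
  nlinarith [mul_le_mul_of_nonneg_left hae hγ, mul_le_mul_of_nonneg_left hae hα,
    mul_le_mul_of_nonneg_left hbd hδ, mul_le_mul_of_nonneg_left hbd hβ]

end Abstract

/-! ## The configuration rows -/

variable {c : Fin 14 → EuclideanSpace ℝ (Fin 3)}

/-- **No ball's direction inside a tight shell triangle.** Shell balls `a, b, d` pairwise touching,
and any other ball `x ∉ {0, a, b, d}` (a shell ball, or the intruder provided `D² < 8/3`): the
direction `gapDir c x` is not a nonnegative combination of `u_a, u_b, u_d` — it does not lie in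
the closed spherical triangle `a b d`. (For a shell `x` this is "no rattler inside an
x-triangle"; the circumradius of the `60°`-triangle is `35.26°`.) -/
theorem IsGapConfig.not_in_xTriangle (hc : IsGapConfig c) (hD : intruderDist c ^ 2 < 8 / 3)
    {a b d x : Fin 14} (ha0 : a ≠ 0) (ha13 : a ≠ 13) (hb0 : b ≠ 0) (hb13 : b ≠ 13) (hd0 : d ≠ 0)
    (hd13 : d ≠ 13) (hx0 : x ≠ 0) (hxa : x ≠ a) (hxb : x ≠ b) (hxd : x ≠ d)
    (hab : dist (c a) (c b) = 1) (had : dist (c a) (c d) = 1) (hbd : dist (c b) (c d) = 1)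
    {α β γ : ℝ} (hα : 0 ≤ α) (hβ : 0 ≤ β) (hγ : 0 ≤ γ) :
    gapDir c x ≠ α • gapDir c a + β • gapDir c b + γ • gapDir c d := by
  intro h
  have hD1 := hc.one_le_intruderDist
  have h1 := hc.inner_gapDir_eq ha0 hb0 hab
  have h2 := hc.inner_gapDir_eq ha0 hd0 had
  have h3 := hc.inner_gapDir_eq hb0 hd0 hbd
  rw [tightLevel_of_ne ha13 hb13] at h1
  rw [tightLevel_of_ne ha13 hd13] at h2
  rw [tightLevel_of_ne hb13 hd13] at h3
  have hxa' := hc.inner_gapDir_le hx0 ha0 hxa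
  have hxb' := hc.inner_gapDir_le hx0 hb0 hxb
  have hxd' := hc.inner_gapDir_le hx0 hd0 hxd
  -- the separation level of `x`: `1/2` for a shell ball, `D/2` for the intruder
  by_cases hx13 : x = 13
  · subst hx13
    rw [tightLevel_of_left] at hxa' hxb' hxd'
    exact not_comb3_of_inner_le (hc.norm_gapDir ha0) (hc.norm_gapDir hb0) (hc.norm_gapDir hd0)
      (hc.norm_gapDir hx0) h1 h2 h3 (s := intruderDist c / 2) (by linarith) (by nlinarith)
      hxa' hxb' hxd' hα hβ hγ h
  · rw [tightLevel_of_ne hx13 ha13] at hxa'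
    rw [tightLevel_of_ne hx13 hb13] at hxb'
    rw [tightLevel_of_ne hx13 hd13] at hxd'
    exact not_comb3_of_inner_le (hc.norm_gapDir ha0) (hc.norm_gapDir hb0) (hc.norm_gapDir hd0)
      (hc.norm_gapDir hx0) h1 h2 h3 (s := 1 / 2) (by norm_num) (by norm_num)
      hxa' hxb' hxd' hα hβ hγ h

/-- **No shell direction inside a tight `p`-triangle.** Shell balls `a, b` touching each other and
both touching the intruder; any other shell ball `x`: `gapDir c x` is not a nonnegative combination
of `p = gapDir c 13`, `u_a`, `u_b` ("no rattler inside a p-triangle"). -/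
theorem IsGapConfig.not_in_pTriangle (hc : IsGapConfig c) {a b x : Fin 14} (ha0 : a ≠ 0)
    (ha13 : a ≠ 13) (hb0 : b ≠ 0) (hb13 : b ≠ 13) (hx0 : x ≠ 0) (hx13 : x ≠ 13) (hxa : x ≠ a)
    (hxb : x ≠ b) (hab : dist (c a) (c b) = 1) (ha : dist (c 13) (c a) = 1)
    (hb : dist (c 13) (c b) = 1) {α β γ : ℝ} (hα : 0 ≤ α) (hβ : 0 ≤ β) (hγ : 0 ≤ γ) :
    gapDir c x ≠ α • gapDir c 13 + β • gapDir c a + γ • gapDir c b := by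
  intro h
  have h13 : (13 : Fin 14) ≠ 0 := by decide
  have hpa := hc.inner_gapDir_eq h13 ha0 ha
  have hpb := hc.inner_gapDir_eq h13 hb0 hb
  have h3 := hc.inner_gapDir_eq ha0 hb0 hab
  rw [tightLevel_of_left] at hpa hpb
  rw [tightLevel_of_ne ha13 hb13] at h3
  have hxp := hc.inner_gapDir_le hx0 h13 hx13
  have hxa' := hc.inner_gapDir_le hx0 ha0 hxa
  have hxb' := hc.inner_gapDir_le hx0 hb0 hxb
  rw [tightLevel_of_right] at hxp
  rw [tightLevel_of_ne hx13 ha13] at hxa'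
  rw [tightLevel_of_ne hx13 hb13] at hxb'
  exact not_comb_pTriangle_of_inner_le (hc.norm_gapDir h13) (hc.norm_gapDir ha0)
    (hc.norm_gapDir hb0) (hc.norm_gapDir hx0) hpa hpb h3 hxp hxa' hxb' hα hβ hγ h

/-- **No shell direction inside a tight shell rhombus.** A tight 4-cycle `a–b–e–d` of shell balls
and any other shell ball `x`: `gapDir c x` is not a nonnegative combination of
`u_a, u_b, u_e, u_d` ("no rattler inside an x-rhombus"). -/
theorem IsGapConfig.not_in_xRhombus (hc : IsGapConfig c) {a b e d x : Fin 14} (ha0 : a ≠ 0)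
    (ha13 : a ≠ 13) (hb0 : b ≠ 0) (hb13 : b ≠ 13) (he0 : e ≠ 0) (he13 : e ≠ 13) (hd0 : d ≠ 0)
    (hd13 : d ≠ 13) (hx0 : x ≠ 0) (hx13 : x ≠ 13) (hxa : x ≠ a) (hxb : x ≠ b) (hxe : x ≠ e)
    (hxd : x ≠ d) (hab : dist (c a) (c b) = 1) (hbe : dist (c b) (c e) = 1)
    (hed : dist (c e) (c d) = 1) (hda : dist (c d) (c a) = 1) {α β γ δ : ℝ} (hα : 0 ≤ α)
    (hβ : 0 ≤ β) (hγ : 0 ≤ γ) (hδ : 0 ≤ δ) :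
    gapDir c x ≠ α • gapDir c a + β • gapDir c b + γ • gapDir c e + δ • gapDir c d := by
  intro h
  have h1 := hc.inner_gapDir_eq ha0 hb0 hab
  have h2 := hc.inner_gapDir_eq hb0 he0 hbe
  have h3 := hc.inner_gapDir_eq he0 hd0 hed
  have h4 := hc.inner_gapDir_eq hd0 ha0 hda
  rw [tightLevel_of_ne ha13 hb13] at h1
  rw [tightLevel_of_ne hb13 he13] at h2
  rw [tightLevel_of_ne he13 hd13] at h3
  rw [tightLevel_of_ne hd13 ha13] at h4
  have hxa' := hc.inner_gapDir_le hx0 ha0 hxa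
  have hxb' := hc.inner_gapDir_le hx0 hb0 hxb
  have hxe' := hc.inner_gapDir_le hx0 he0 hxe
  have hxd' := hc.inner_gapDir_le hx0 hd0 hxd
  rw [tightLevel_of_ne hx13 ha13] at hxa'
  rw [tightLevel_of_ne hx13 hb13] at hxb'
  rw [tightLevel_of_ne hx13 he13] at hxe'
  rw [tightLevel_of_ne hx13 hd13] at hxd'
  exact not_comb4_rhombus_of_inner_le (hc.norm_gapDir ha0) (hc.norm_gapDir hb0)
    (hc.norm_gapDir he0) (hc.norm_gapDir hd0) (hc.norm_gapDir hx0) h1 h2 h3 h4 hxa' hxb' hxe'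
    hxd' hα hβ hγ hδ h

end Summit.Ventures.Crystal3D
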